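import Literature.MathematicalPhysics.QuantumFieldTheory.BalabanImbrieJaffe1984to88.BIJ85Ineq722DeltaA
import Literature.MathematicalPhysics.QuantumFieldTheory.Balaban1983to89.B5Prop12GHolds
import Literature.MathematicalPhysics.QuantumFieldTheory.BalabanImbrieJaffe1984to88.BIJ85Thm711TorusTransport

/-!
# `BalabanImbrieJaffe1984to88.BIJ85Prop12BridgeGeometry` — T. Bałaban, J. Imbrie, A. Jaffe, *Renormalization of the Higgs model:
minimizers, propagators and the stability of mean field theory*, Commun. Math. Phys. **97** (1985) 299–329 [BalabanImbrieJaffe1985],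
Sect. 7.2 p. 325 (7.2.1)–(7.2.2) *"This inequality is a consequence of Proposition 1.2 and the representation (1.103) of [6I]"*, with
[6I] = T. Bałaban, *Propagators and renormalization transformations for lattice gauge theories. I*, Commun. Math. Phys. **95** (1984)
17–40 [Balaban1984PropagatorsI], Proposition 1.2 (1.110)–(1.114) pp. 35–36.

statement-level skeleton of published theorems with citation tags; proofs where landed; nothing here is a claim about the Yang–Mills mass gap

CITATION HEADER (lean-in-tree rule).  Part of the lit-balaban TYPED SKELETON (HOME `run/shared/lean/pub/lit-balaban/`), Phase-2 proof
seat p19 gen 6 (free target of the C1 fold owner r15, HOME/STATUS 2026-08-21T20:16:20Z): THE [6I] PROPOSITION 1.2 FAMILY BRIDGE.  The tree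
holds Proposition 1.2 of [6I] for `G = Δ_a⁻¹` PROVED hypothesis-free on the torus family of record
(`…Balaban1983to89.B5Prop12GHolds.prop12_famG_printed`, real weighted setting `B5SettingP12Real.latticeSettingP12R n M a K` on the product
tori `Tor (fine n M)`, `Tor M` of `B5Prop11Plancherel`), while every Sect. 7.2 / [BalabanImbrieJaffe1988] §2 torus theorem «given only [6I]
Prop. 1.2 by name» consumes the OTHER encoding `BIJ85Ineq722ProofPart2.settingOf (BIJ85Ineq722Torus.torusRep P k (BIJ85Ineq722DeltaA.deltaAData
hk a)) k` on the `Setup` tori `Balaban1983to89.Site P 0`, `Balaban1983to89.Site P k`.  THIS FILE (1 of the bridge): the GEOMETRIC DICTIONARY between the two encodings —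
file 2 the kernels and the sup members (1.110), file 3 the Hölder member (1.111), file 4 the scale `k = 0`, file 5 the assembly
`prop12Printed_levStd`.

THE PRINTED TEXT the dictionary serves (verbatim, [6I] p. 35 [PDF 19]): *"for arbitrary T_η, y, y′ ∈ T₁^{(k)} and J satisfying the condition
supp J ⊂ Δ̃(y′) … |(GJ)(x)|, |(∇GJ)(x)|, … ≤ O(1)e^{−δ₀|y−y′|}|J| (1.110) for x ∈ Δ̃(y) … Cubes Δ(y) are simply unit cubes of T_η, or
Δ(y) = B^k(y), y ∈ T₁^{(k)}.  Cubes Δ̃(y) are sums of 2^d unit cubes having the point y as a corner, thus they are cubes of size 2 and with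
a center at y."*

WHAT IS PROVED (every declaration below is a definition-free theorem; no Prop-valued fact is introduced).  With `n = L^k` and
`M = B5Eq117TorusCarriers.Mk P k` (so that `Balaban1983to89.Site P k` IS `Tor M` and `B5Eq117TorusCarriers.EK hk : Balaban1983to89.Site P 0 ≃ Tor (fine n M)` is p09's
kernel identification of `BIJ85Ineq722DeltaA.Gk`):
* §1 the unit-lattice distances agree: `(supDist y y′ : ℝ) = distSite M y y′` (`supDist_cast_eq_distSite`);
* §2 `EK` is coordinatewise value-preserving (`EK_val`; unit steps go to unit steps by p34's `BIJ85Thm711TorusTransport.EK_shift`), the fine distances agree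
  (`cdistF_EK`, `distSite_EK`, `distU_EK` : `distU (EK x) (EK x′) = |x − x′|_∞/L^k` = p09's `dS`);
* §3 blocks and cubes: `EK x ∈ cubeT n M (x_k)` for the `k`-block `x_k = iterBlockOf k x` (`EK_mem_cubeT_blk`: the unit cube `Δ(x_k) ∋ x` lies in
  the corner-centred cube `Δ̃(x_k)` of the product encoding); p09's centred open cube `{x : |x − ctr y|_∞ < L^k}` forces `|x_k − y|_∞ ≤ 1`
  (`supDist_blk_le_one_of_mem_cube`); two product cubes with a common point have labels at distance `≤ 3` (`distSite_le_three_of_mem_mem`);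
  fine points at most one unit apart have blocks at most one unit apart (`supDist_blk_le_one_of_dS_le_one`).
HONEST SCOPE.  Bookkeeping between two typings of the same finite torus `T_η` (η = L^{−k}) and of its unit lattice; nothing analytic and
nothing of either paper is asserted.  The two cube conventions differ (centred open cubes of p09's `torusRep` — DIVERGENCE F3 of the cell —
versus the printed corner cubes of r02's `cubeT`); the bridge below never identifies them, it only uses `Δ(y) ⊂ Δ̃(y)` in the product
encoding and the `ℓ^∞` bookkeeping of labels.  Unit `lit-balaban-p19` (literature-prover-lit-balaban-p19-g6-0), 2026-08-21.
-/

namespace Literature.MathematicalPhysics.QuantumFieldTheory.BalabanImbrieJaffe1984to88.BIJ85Prop12BridgeGeometry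

open Literature.MathematicalPhysics.QuantumFieldTheory.Balaban1983to89
open scoped BigOperators
open LatticeFieldCalculus (supDist)
open B3TorusRadialSums (cdist supDist_eq_sup_cdist cdist_le_supDist supDist_comm)
open B5Eq118OneStroke (iterBlockOf val_iterBlockOf)
open B5Prop11Plancherel (Tor fine unitVec)
open B5Eq117TorusCarriers (Mk EK EK_apply)
open BIJ85Thm711TorusTransport (EK_shift)
open B5Prop12FieldsLattice (cdistF distU distSite toFine cubeT cubeB)
open B5SiteBridgeP12 (toFine_val mem_cubeT_iff distSite_fine_le_iff distU_eq_distSite_div)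
open B5CombesThomasLattice (distU_toFine_le_one_of_mem_cubeT distSite_sub_two_le_distU_toFine)
open BIJ85Ineq722Torus (ctr val_ctr torusRep TorusData supDist_triangle supDist_ctr_ctr supDist_ctr_blk_le supDist_blk_le_one)

noncomputable section

variable {P : Params} {k : ℕ}

/-! ## §1  The unit lattice: `Balaban1983to89.Site P k` IS `Tor (Mk P k)`, and `|y − y′|_∞ = distSite` -/

/-- the circular size of `B3TorusRadialSums` is the absolute value of Mathlib's `valMinAbs`. [folklore] -/
private theorem cdist_eq_natAbs_valMinAbs {N : ℕ} [NeZero N] (m : ZMod N) : cdist m = m.valMinAbs.natAbs := by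
  rw [ZMod.valMinAbs_natAbs_eq_min, cdist, ZMod.neg_val]
  by_cases hm : m = 0
  · subst hm; simp
  · rw [if_neg hm]

/-- **the unit-lattice distances agree**: p09's `|y − y′| = |y − y′|_∞` (`LatticeFieldCalculus.supDist`, lattice steps of `T^{(k)}`) is r02's
`distSite (Mk P k)` on the same type `Balaban1983to89.Site P k = Tor (Mk P k)`. [cite: Balaban1984PropagatorsI, Prop. 1.2 (1.110) p.35 (e^{−δ₀|y−y′|})] -/
theorem supDist_cast_eq_distSite (y y' : Balaban1983to89.Site P k) : (supDist y y' : ℝ) = distSite (Mk P k) y y' := by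
  unfold distSite
  rw [supDist_eq_sup_cdist]
  congr 2
  funext μ
  exact cdist_eq_natAbs_valMinAbs _

/-! ## §2  The fine lattice through `EK : Balaban1983to89.Site P 0 ≃ Tor (fine (L^k) (Mk P k))` -/

/-- `EK` preserves coordinates. [cite: Balaban1984PropagatorsI, (1.18) p.20] -/
theorem EK_val (hk : k ≤ P.m + P.K) (x : Balaban1983to89.Site P 0) (μ : Fin P.d) : (EK hk x μ).val = (x μ).val := by
  rw [EK_apply]; exact ZMod.ringEquivCongr_val _ _

/-- `EK` is additive coordinatewise (differences of sites ↦ differences). [cite: Balaban1984PropagatorsI, (1.18) p.20] -/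
theorem EK_sub_apply (hk : k ≤ P.m + P.K) (x x' : Balaban1983to89.Site P 0) (μ : Fin P.d) :
    EK hk x μ - EK hk x' μ
      = ZMod.ringEquivCongr ((B5Eq117TorusCarriers.sitesPerDir_zero_eq_towerM hk μ).trans
          (B5TowerOneStroke.towerM_eq_fine P.L (Mk P k) k μ)) (x μ - x' μ) := by
  rw [EK_apply, EK_apply, map_sub]

/-- `valMinAbs` is invariant under `ZMod.ringEquivCongr`. [folklore] -/
private theorem valMinAbs_ringEquivCongr {a b : ℕ} (h : a = b) (x : ZMod a) : (ZMod.ringEquivCongr h x).valMinAbs = x.valMinAbs := by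
  subst h
  rw [ZMod.ringEquivCongr_refl]
  rfl

/-- **the fine coordinate distances agree**: `cdistF (EK x) (EK x′) μ = cdist (x_μ − x′_μ)`. [cite: Balaban1984PropagatorsI, (1.109) p.35 (|x − x′|)] -/
theorem cdistF_EK (hk : k ≤ P.m + P.K) (x x' : Balaban1983to89.Site P 0) (μ : Fin P.d) :
    cdistF (P.L ^ k) (Mk P k) (EK hk x) (EK hk x') μ = cdist (x μ - x' μ) := by
  unfold cdistF
  rw [EK_sub_apply, valMinAbs_ringEquivCongr, cdist_eq_natAbs_valMinAbs]

/-- **the fine sup distances agree** (in fine steps): `distSite (fine n M) (EK x) (EK x′) = |x − x′|_∞`.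
[cite: Balaban1984PropagatorsI, (1.109) p.35 (|x − x′|)] -/
theorem distSite_EK (hk : k ≤ P.m + P.K) (x x' : Balaban1983to89.Site P 0) :
    distSite (fine (P.L ^ k) (Mk P k)) (EK hk x) (EK hk x') = (supDist x x' : ℝ) := by
  unfold distSite
  rw [supDist_eq_sup_cdist]
  congr 2
  funext μ
  have h := cdistF_EK hk x x' μ
  unfold cdistF at h
  rw [h]

/-- **`distU (EK x) (EK x′) = |x − x′|_∞ / L^k`** = p09's `(torusRep P k D).dS x x′` (distances on `T_η` in the unit of `T₁^{(k)}`).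
[cite: BalabanImbrieJaffe1985, (7.2.2) p.325 (|x − x′| ≤ 1)] -/
theorem distU_EK (hk : k ≤ P.m + P.K) (x x' : Balaban1983to89.Site P 0) :
    distU (P.L ^ k) (Mk P k) (EK hk x) (EK hk x') = (supDist x x' : ℝ) / (P.L : ℝ) ^ k := by
  rw [distU_eq_distSite_div, distSite_EK]
  push_cast
  rfl

/-- the same, read as p09's `dS`. [cite: BalabanImbrieJaffe1985, (7.2.2) p.325] -/
theorem distU_EK_eq_dS (hk : k ≤ P.m + P.K) (D : TorusData P k) (x x' : Balaban1983to89.Site P 0) :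
    distU (P.L ^ k) (Mk P k) (EK hk x) (EK hk x') = (torusRep P k D).dS x x' := by
  rw [distU_EK, BIJ85Ineq722Torus.torusRep_dS]

/-! ## §3  Blocks and the two cube conventions -/

/-- `1 ≤ L^k`. [folklore] -/
private theorem one_le_pow_L (P : Params) (k : ℕ) : 1 ≤ P.L ^ k := Nat.one_le_pow _ _ P.L_pos

/-- **`x ∈ Δ(x_k) ⊂ Δ̃(x_k)` in the product encoding**: `EK x ∈ cubeT (L^k) (Mk P k) (iterBlockOf k x)` (the label of `x` is within
`L^k − 1 < L^k` fine steps above `L^k·x_k` coordinatewise). [cite: Balaban1984PropagatorsI, p.35 («Δ(y) = B^k(y)», «Δ̃(y) … having the point y as a corner»)] -/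
theorem EK_mem_cubeT_blk (hk : k ≤ P.m + P.K) (x : Balaban1983to89.Site P 0) :
    EK hk x ∈ cubeT (P.L ^ k) (Mk P k) (iterBlockOf k x) := by
  rw [mem_cubeT_iff]
  intro μ
  have hL : 0 < P.L ^ k := one_le_pow_L P k
  -- the label of `x` minus the corner label is the remainder modulo `L^k`
  have hxv : (EK hk x μ).val = (x μ).val := EK_val hk x μ
  have htv : (toFine (P.L ^ k) (Mk P k) (iterBlockOf k x) μ).val = P.L ^ k * ((x μ).val / P.L ^ k) := by
    rw [toFine_val, val_iterBlockOf k hk x μ]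
  have hle : (toFine (P.L ^ k) (Mk P k) (iterBlockOf k x) μ).val ≤ (EK hk x μ).val := by
    rw [hxv, htv]; exact Nat.mul_div_le _ _
  have hsub : (EK hk x μ - toFine (P.L ^ k) (Mk P k) (iterBlockOf k x) μ).val = (x μ).val % P.L ^ k := by
    rw [ZMod.val_sub hle, hxv, htv]
    have := Nat.div_add_mod ((x μ).val) (P.L ^ k)
    omega
  unfold cdistF
  rw [← cdist_eq_natAbs_valMinAbs]
  calc cdist (EK hk x μ - toFine (P.L ^ k) (Mk P k) (iterBlockOf k x) μ)
      ≤ (EK hk x μ - toFine (P.L ^ k) (Mk P k) (iterBlockOf k x) μ).val := B3TorusRadialSums.cdist_le_val _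
    _ = (x μ).val % P.L ^ k := hsub
    _ ≤ P.L ^ k := (Nat.mod_lt _ hL).le

/-- unfolding of p09's centred cube: `x ∈ Δ̃(y)` of `torusRep` iff `|x − ctr y|_∞ < L^k` (fine steps).
[cite: BalabanImbrieJaffe1985, (7.2.1) p.325; Balaban1984PropagatorsI, p.35 (the cubes Δ̃(y))] -/
theorem mem_cube_iff_supDist_lt (D : TorusData P k) (y : Balaban1983to89.Site P k) (x : Balaban1983to89.Site P 0) :
    x ∈ (torusRep P k D).cube y ↔ supDist x (ctr k y) < P.L ^ k := by
  rw [BIJ85Ineq722Torus.mem_cube_iff]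
  have hL : (0 : ℝ) < (P.L : ℝ) ^ k := pow_pos (by exact_mod_cast P.L_pos) k
  rw [div_lt_one hL]
  norm_cast

/-- **a point of p09's centred cube `Δ̃(y)` has its `k`-block within one unit of `y`**: `|x_k − y|_∞ ≤ 1`
(`L^k|x_k − y|_∞ = |ctr x_k − ctr y|_∞ ≤ (L^k − 1)/2 + (L^k − 1) < 2L^k`). [cite: Balaban1984PropagatorsI, p.35 (the cubes Δ(y), Δ̃(y))] -/
theorem supDist_blk_le_one_of_mem_cube (hk : k ≤ P.m + P.K) (D : TorusData P k) {y : Balaban1983to89.Site P k} {x : Balaban1983to89.Site P 0}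
    (hx : x ∈ (torusRep P k D).cube y) : supDist (iterBlockOf k x) y ≤ 1 := by
  rw [mem_cube_iff_supDist_lt] at hx
  have h1 := supDist_ctr_blk_le hk x
  have h2 := supDist_triangle (ctr k (iterBlockOf k x)) x (ctr k y)
  rw [supDist_comm] at h1
  rw [supDist_ctr_ctr hk] at h2
  have hL := one_le_pow_L P k
  by_contra h3
  rw [not_le] at h3
  have h4 : P.L ^ k * 2 ≤ P.L ^ k * supDist (iterBlockOf k x) y := Nat.mul_le_mul_left _ h3
  omega

/-- **two product cubes with a common fine point have labels at most three units apart**: `x ∈ Δ̃(y₁) ∩ Δ̃(y₂) ⇒ |y₁ − y₂| ≤ 3`.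
[cite: Balaban1984PropagatorsI, p.35 (the cubes Δ̃(y))] -/
theorem distSite_le_three_of_mem_mem {d : ℕ} {n : ℕ} [NeZero n] {M : Fin d → ℕ} [∀ μ, NeZero (M μ)] (hn : 1 ≤ n)
    {x : Tor (fine n M)} {y₁ y₂ : Tor M} (h₁ : x ∈ cubeT n M y₁) (h₂ : x ∈ cubeT n M y₂) : distSite M y₁ y₂ ≤ 3 := by
  have h := distSite_sub_two_le_distU_toFine (n := n) (M := M) hn h₁ y₂
  have h' := distU_toFine_le_one_of_mem_cubeT (n := n) (M := M) h₂
  linarith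

/-- **fine points at most one unit apart have blocks at most one unit apart**: `dS x x′ ≤ 1 ⇒ |x_k − x′_k|_∞ ≤ 1`.
[cite: BalabanImbrieJaffe1985, (5.1.2)–(5.1.3) p.313] -/
theorem supDist_blk_le_one_of_dS_le_one (hk : k ≤ P.m + P.K) (D : TorusData P k) {x x' : Balaban1983to89.Site P 0}
    (h : (torusRep P k D).dS x x' ≤ 1) : supDist (iterBlockOf k x) (iterBlockOf k x') ≤ 1 := by
  rw [BIJ85Ineq722Torus.dS_le_iff, one_mul] at h
  exact supDist_blk_le_one hk x x' (by exact_mod_cast h)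

/-- `dS x x′ ≤ 1 ⇔ distU (EK x) (EK x′) ≤ 1`; recorded as the one-sided consequence used by the Hölder member.
[cite: BalabanImbrieJaffe1985, (7.2.2) p.325 (|x − x′| ≤ 1)] -/
theorem distU_EK_le_one_of_dS_le_one (hk : k ≤ P.m + P.K) (D : TorusData P k) {x x' : Balaban1983to89.Site P 0}
    (h : (torusRep P k D).dS x x' ≤ 1) : distU (P.L ^ k) (Mk P k) (EK hk x) (EK hk x') ≤ 1 := by
  rwa [distU_EK_eq_dS hk D]

/-- **`2 ≤ M_μ`** for the unit lattice `T^{(k)}` of `Setup` (`sitesPerDir k = 2L^{m+K−k}`; the hypothesis of r02's unit-scale Lipschitz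
bounds for the cut-offs). [cite: Balaban1987RG1, (0.1) p.251] -/
theorem two_le_Mk (P : Params) (k : ℕ) (μ : Fin P.d) : 2 ≤ Mk P k μ := by
  show 2 ≤ P.sitesPerDir k
  unfold Params.sitesPerDir
  have := Nat.one_le_pow (P.m + P.K - k) P.L P.L_pos
  omega

end

end Literature.MathematicalPhysics.QuantumFieldTheory.BalabanImbrieJaffe1984to88.BIJ85Prop12BridgeGeometry
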